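import Summits.BirchSwinnertonDyer.Rank1Residual.Supersingular.X6VisibilityTamDefectShape
import HarnessLib

/-!
# N4 TAM-DEFECT by VISIBILITY — RECORDS: `BSD(E,5)` for `22678e1` (X6, `r_an = 0`, `#Ш_an = 25`, `5² ∣ ∏c_ℓ`) from
# the `5`-congruent rank-`2` curve `430882i1`, Wuthrich's upper bound, Cassels–Tate and the four-kind refined count

Cell `b2b-bsdres`, supersingular family, prover A = unit `b2b-bsdres-x10b` (gen 15), N4 class lead.  Topic file;
namespace `Summit.BirchSwinnertonDyer.Rank1Residual.Supersingular`.  THEOREMS ONLY; no named fact, no definition,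
nothing booked; X6 stays CONSTRUCTION-SHAPED (mark of RESIDUAL-MAP §I N4 unchanged).  Shape and the account of the
method: `X6VisibilityTamDefectShape.lean` (module docstring).

HONEST FRAMING (run/shared/lean/b2b/bsd-rank1-residual/, verbatim in every file): the goal of the cell is to
DELETE the COMBINATION-SHAPED residual classes of the Birch–Swinnerton-Dyer formula for ALL analytic-rank `≤ 1`
elliptic curves over `ℚ` — "full BSD formula for every rank `≤ 1` curve in class `C`" assembled STRICTLY from
published theorems — so that the rank-`≤ 1` remainder becomes exactly the CONSTRUCTION-SHAPED classes, which are
TYPED (missing-input `Prop`s), NOT attempted.  This is not "finishing BSD".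

References: Cremona–Mazur 2000 §3 [CremonaMazur2000]; Fisher 2016 Thm. 4.4 [Fisher2016Visualizing7]; Fisher 2012
Thm. 13.2 [Fisher2012Hessian]; Wuthrich 2014 Prop. 21 [Wuthrich2014]; Silverman AEC VII.5.1, X.4.14
[SilvermanAEC2009]; ATAEC V [SilvermanATAEC1994]; Cremona's tables [Cremona2006]; HOME/b2b-bsdres-x10b/X6-KURIHARA.md §18.
-/

set_option autoImplicit false

noncomputable section

open scoped Classical

open WeierstrassCurve Literature.NumberTheory.EllipticCurves
  Literature.NumberTheory.EllipticCurves.Rank1Residual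
  Literature.NumberTheory.EllipticCurves.Rank1Residual.Typed
  Literature.NumberTheory.EllipticCurves.Rank1Residual.X11RankOneCertificates
  Literature.NumberTheory.EllipticCurves.Wuthrich2014
  Literature.NumberTheory.EllipticCurves.Fisher2016
  Literature.NumberTheory.EllipticCurves.Fisher2012
  Summit.BirchSwinnertonDyer.BirchSwinnertonDyer.Rank1Residual.IntModel
  Summit.BirchSwinnertonDyer.Rank1Residual.X11b
open NumberField IsDedekindDomain Rat.HeightOneSpectrum

namespace Summit.BirchSwinnertonDyer.Rank1Residual.Supersingular

/-! ### §3. The record: `BSD(E,5)` for `22678e1` from the `5`-congruent rank-`2` curve `430882i1` -/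

/-- `22678e1` (Cremona's minimal model) is an elliptic curve: `Δ ≠ 0`. [cite: Cremona2006, Table 1 (Cremona label 22678e1)] -/
theorem isElliptic_c22678e1 : (⟨1, 0, 0, 3140254662, -139987982322460⟩ : WeierstrassCurve ℚ).IsElliptic :=
  isElliptic_of_discOf_ne_zero 1 0 0 3140254662 (-139987982322460) (by decide +kernel)

/-- `22678e1` is globally minimal (Kraus' bounded criterion, kernel). [cite: SilvermanAEC2009, VII.1 Remark 1.1] -/
theorem isGloballyMinimal_c22678e1 :
    (⟨1, 0, 0, 3140254662, -139987982322460⟩ : WeierstrassCurve ℚ).IsGloballyMinimal :=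
  isGloballyMinimal_of_krausCriterion_bounded₂ 1 0 0 3140254662 (-139987982322460) (by decide +kernel)
    (by decide +kernel) (by decide +kernel)

/-- `430882i1` (Cremona's minimal model) is an elliptic curve: `Δ ≠ 0`. [cite: Cremona2006, Table 1 (Cremona label 430882i1)] -/
theorem isElliptic_c430882i1 : (⟨1, 0, 0, -14128, -645920⟩ : WeierstrassCurve ℚ).IsElliptic :=
  isElliptic_of_discOf_ne_zero 1 0 0 (-14128) (-645920) (by decide +kernel)

/-- `430882i1` is globally minimal (Kraus' bounded criterion, kernel). [cite: SilvermanAEC2009, VII.1 Remark 1.1] -/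
theorem isGloballyMinimal_c430882i1 : (⟨1, 0, 0, -14128, -645920⟩ : WeierstrassCurve ℚ).IsGloballyMinimal :=
  isGloballyMinimal_of_krausCriterion_bounded₂ 1 0 0 (-14128) (-645920) (by decide +kernel) (by decide +kernel)
    (by decide +kernel)

/-- `#Ẽ(𝔽₅) = 6` for `22678e1` (`a₅ = 0`: good SUPERSINGULAR at `5`; kernel count). [folklore] -/
theorem card_c22678e1_5 :
    Nat.card (((⟨1, 0, 0, 3140254662, -139987982322460⟩ : WeierstrassCurve ℤ).map
      (Int.castRingHom (ZMod 5))).toAffine.Point) = 6 :=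
  haveI : Fact (Nat.Prime 5) := ⟨by norm_num⟩
  natCard_point_eq_of_countPoints 1 0 0 3140254662 (-139987982322460) 5 (by norm_num) (by decide +kernel)
    (by decide +kernel)

/-- The node-tangent quadratic of `430882i1` mod `19` has no root: NON-split multiplicative reduction at `19`
(`a₁₉ = −1`; kernel). [folklore] -/
theorem noroot_c430882i1_19 : ∀ t : ZMod 19,
    ((⟨1, 0, 0, -14128, -645920⟩ : WeierstrassCurve ℤ).c₄ : ZMod 19) * t ^ 2 +
      ((⟨1, 0, 0, -14128, -645920⟩ : WeierstrassCurve ℤ).a₁ * (⟨1, 0, 0, -14128, -645920⟩ : WeierstrassCurve ℤ).c₄ :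
        ZMod 19) * t -
      (54 * (⟨1, 0, 0, -14128, -645920⟩ : WeierstrassCurve ℤ).b₆ -
        3 * (⟨1, 0, 0, -14128, -645920⟩ : WeierstrassCurve ℤ).b₂ * (⟨1, 0, 0, -14128, -645920⟩ : WeierstrassCurve ℤ).b₄ +
        (⟨1, 0, 0, -14128, -645920⟩ : WeierstrassCurve ℤ).a₂ * (⟨1, 0, 0, -14128, -645920⟩ : WeierstrassCurve ℤ).c₄ :
        ZMod 19) ≠ 0 := by
  decide +kernel

/-- **`BSD(E,5)` for `22678e1`** (N4 TAM-DEFECT cell: class X6, `N = 22678 = 2·17·23·29`, good supersingular at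
`5` (`a₅ = 0`), `r_an = 0`, `#E(ℚ)_tors = 3`, `∏c_ℓ = 150` (`c₂ = 75`: `5² ∣ ∏c`, so NO unit Kurihara number
exists and Kim's route needs a depth-`3` two-prime level ≈ 6.6e11 series terms), `#Ш_an = 25`) from PUBLISHED
theorems — Cassels–Tate (`hCT`), Wuthrich 2014 Prop. 21 (`hW`; NO Tamagawa hypothesis), GZK (`hGZK`), modularity
(`hmod`), Tate uniformisation (`hU`, `hU2`), Fisher 2016 Thm. 4.4 (`hF44`) — and a VISIBLE element of `Ш(E)[5]`
explained by the `5`-CONGRUENT RANK-`2` curve `F = 430882i1` (`N_F = 19·N`; `[1,0,0,−14128,−645920]`,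
generators `(−66,44)`, `(138,124)`).  KERNEL: minimality of both models, `ClassX6 E 5`, the reduction types
used by the count (`E`, `F` multiplicative at `2` and `29`; `E` good and `F` NON-SPLIT multiplicative at `19`;
both good at `5`; good reduction of both off `{2,5,17,19,23,29}` from the discriminant factorisations
`|Δ_E| = 2^75·17·23·29^4`, `Δ_F = 2^5·17·19^5·23·29`), `5 ∤ #E(ℚ)`.  DISPLAYED BINDERS (evidence
HOME/b2b-bsdres-x10b/gen15/: PARI kit j153827 + pure-python `local.py`, agreeing): the `Γ_ℚ`-isomorphism
`θ : F[5] ≅ E[5]` (`hθ` — in THIS form; evidence: `a_ℓ(E) ≡ a_ℓ(F) (mod 5)` at all 12126 good primes `ℓ ≤ 129601` =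
the Sturm bound at level `430882`, kit j153827; the KERNEL form, `θ` from Fisher's Hesse pencil, is
`bsdp_x6r0vis_22678e1_5` below); `rank F(ℚ) ≥ 2` (`hrank`;
Cremona, two-engine independence of the generators in `F(ℚ)/5F(ℚ)`); `#F(ℚ_v)[5] = 1` at the places over `5`
(supersingular), `17` and `23` (non-split, `ℓ ≢ −1 (mod 5)`) (`h5`, `h17`, `h23`); at the places over `2` (both
SPLIT multiplicative) and `29` (both NON-split): `γ(E) = r²γ(F)` in `ℚ_v` and `μ₅(ℚ_v) = 1` (`h2`, `h29`;
`2, 29 ≢ 1 (mod 5)`); the Cremona data `r_an(E) = 0` (`hr0`) and `ord₅ #Ш_an(E) ≤ 2` (`hq`, `hv`).  The count: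
pay `5 · #F(ℚ₅)[5] = 5 < 25 ≤ 5^{rank F}` at `5`; `2`, `29` free of kind (iii); `17`, `23` free of kind (i);
`19` free of kind (iv) (Fisher 2016 Thm. 4.4).  Per pair (an OFFER for referee A); NOT a class theorem; nothing
booked. [cite: Wuthrich2014, Prop. 21 (p. 400)] [cite: Fisher2016Visualizing7, Thm. 4.4 (p. 106)]
[cite: CremonaMazur2000, §3 and Table 1] [cite: SilvermanAEC2009, VII.5 Prop. 5.1 and Thm. X.4.14]
[cite: SilvermanATAEC1994, Ch. V Thm. 3.1, Lemma 5.2, Thm. 5.3, Cor. 5.4] [cite: Cremona2006, Table 1 (Cremona labels 22678e1, 430882i1)] -/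
theorem bsdp_x6r0vis_22678e1_5_of_congr
    (hCT : exists_casselsTate_pairing (K := ℚ)) (hW : sha_dvd_analyticSha)
    (hGZK : rank_eq_analyticRank_of_analyticRank_le_one) (hmod : hasEntireLFunction_rat)
    (hU : Silverman1994_thmV53_tateUniformisation.{0})
    (hU2 : Silverman1994_thmV53_corV54_tateUniformisation.{0})
    (hF44 : thm44_selmerLocalKer_iff_of_nonsplit_good)
    {W F : WeierstrassCurve ℚ} [W.IsElliptic] [W.IsGloballyMinimal] [F.IsElliptic] [F.IsGloballyMinimal]
    (hWeq : W = ⟨1, 0, 0, 3140254662, -139987982322460⟩) (hFeq : F = ⟨1, 0, 0, -14128, -645920⟩)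
    -- Cremona data of the target
    (hr0 : W.analyticRank = 0) {q : ℚ} (hq : shaAn W = (q : ℂ)) (hv : padicValRat 5 q ≤ 2)
    -- the 5-congruence (displayed binder in this form; the Hesse-certificate form below DISCHARGES it)
    (θ : geomTorsion F (5 : ℤ) ≃+ geomTorsion W (5 : ℤ))
    (hθ : ∀ (σ : Field.absoluteGaloisGroup ℚ) (P : geomTorsion F (5 : ℤ)), θ (σ • P) = σ • θ P)
    -- the partner's rank
    (hrank : 2 ≤ F.mordellWeilRank)
    -- local data of the partner / the pair (displayed binders)
    (h5 : ∀ w : HeightOneSpectrum (𝓞 ℚ), (primesEquiv w : ℕ) = 5 →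
      Nat.card (nsmulAddMonoidHom 5 : (F.baseChange (w.adicCompletion ℚ)).toAffine.Point →+ _).ker = 1)
    (h17 : ∀ w : HeightOneSpectrum (𝓞 ℚ), (primesEquiv w : ℕ) = 17 →
      Nat.card (nsmulAddMonoidHom 5 : (F.baseChange (w.adicCompletion ℚ)).toAffine.Point →+ _).ker = 1)
    (h23 : ∀ w : HeightOneSpectrum (𝓞 ℚ), (primesEquiv w : ℕ) = 23 →
      Nat.card (nsmulAddMonoidHom 5 : (F.baseChange (w.adicCompletion ℚ)).toAffine.Point →+ _).ker = 1)
    (h2 : ∀ w : HeightOneSpectrum (𝓞 ℚ), (primesEquiv w : ℕ) = 2 →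
      (∃ r : w.adicCompletion ℚ, algebraMap ℚ (w.adicCompletion ℚ) (-(W.c₄ / W.c₆)) =
          r ^ 2 * algebraMap ℚ (w.adicCompletion ℚ) (-(F.c₄ / F.c₆))) ∧
        (∀ ζ : w.adicCompletion ℚ, ζ ^ 5 = 1 → ζ = 1))
    (h29 : ∀ w : HeightOneSpectrum (𝓞 ℚ), (primesEquiv w : ℕ) = 29 →
      (∃ r : w.adicCompletion ℚ, algebraMap ℚ (w.adicCompletion ℚ) (-(W.c₄ / W.c₆)) =
          r ^ 2 * algebraMap ℚ (w.adicCompletion ℚ) (-(F.c₄ / F.c₆))) ∧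
        (∀ ζ : w.adicCompletion ℚ, ζ ^ 5 = 1 → ζ = 1)) :
    BSDp W 5 := by
  haveI : Fact (Nat.Prime 5) := ⟨by norm_num⟩
  haveI : Fact (Nat.Prime 19) := ⟨by norm_num⟩
  have hIW : integralModelInt W = ⟨1, 0, 0, 3140254662, -139987982322460⟩ :=
    integralModelInt_eq_of_map_eq _ (by rw [hWeq]; ext <;> simp [WeierstrassCurve.map])
  have hIF : integralModelInt F = ⟨1, 0, 0, -14128, -645920⟩ :=
    integralModelInt_eq_of_map_eq _ (by rw [hFeq]; ext <;> simp [WeierstrassCurve.map])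
  -- class X6 at 5 for the target
  have hX : ClassX6 W 5 :=
    classX6_of_intModel 5 le_rfl hIW (by decide +kernel) card_c22678e1_5 (by decide) (by decide +kernel)
  -- the prime lists: every prime divisor of Δ_E, Δ_F lies in L
  set L : List ℕ := [2, 5, 17, 19, 23, 29] with hL
  have hLp : ∀ q ∈ L, q.Prime := by decide
  have hΔE : ∀ q : ℕ, q.Prime → (q : ℤ) ∣ (⟨1, 0, 0, 3140254662, -139987982322460⟩ : WeierstrassCurve ℤ).Δ →
      q ∈ L :=
    forall_mem_of_natAbs_eq_prod_pow L [75, 0, 1, 0, 1, 4] hLp (by decide +kernel)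
  have hΔF : ∀ q : ℕ, q.Prime → (q : ℤ) ∣ (⟨1, 0, 0, -14128, -645920⟩ : WeierstrassCurve ℤ).Δ → q ∈ L :=
    forall_mem_of_natAbs_eq_prod_pow L [5, 0, 1, 5, 1, 1] hLp (by decide +kernel)
  -- the sets of places S (over L) and T (over 5)
  set e := primesEquiv (R := 𝓞 ℚ) with he
  set v₅ : HeightOneSpectrum (𝓞 ℚ) := e.symm ⟨5, Fact.out⟩ with hv₅def
  have hv₅ : (e v₅ : ℕ) = 5 := by rw [hv₅def, Equiv.apply_symm_apply]
  have heq5 : ∀ w : HeightOneSpectrum (𝓞 ℚ), (e w : ℕ) = 5 → w = v₅ := by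
    intro w hw
    have h1 : e w = ⟨5, Fact.out⟩ := Subtype.ext hw
    rw [hv₅def, ← h1, Equiv.symm_apply_apply]
  set S : Finset (HeightOneSpectrum (𝓞 ℚ)) :=
    (L.filterMap fun r ↦ if h : r.Prime then some (e.symm ⟨r, h⟩) else none).toFinset with hSdef
  have hmemS : ∀ w : HeightOneSpectrum (𝓞 ℚ), w ∈ S ↔ (e w : ℕ) ∈ L := by
    intro w
    rw [hSdef, List.mem_toFinset, List.mem_filterMap]
    constructor
    · rintro ⟨r, hr, hrw⟩
      by_cases hrp : r.Prime
      · rw [dif_pos hrp, Option.some.injEq] at hrw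
        rw [← hrw, Equiv.apply_symm_apply]
        exact hr
      · rw [dif_neg hrp] at hrw
        exact absurd hrw (by simp)
    · intro hw
      refine ⟨(e w : ℕ), hw, ?_⟩
      rw [dif_pos (e w).2]
      simp
  set T : Finset (HeightOneSpectrum (𝓞 ℚ)) := {v₅} with hTdef
  have hTS : T ⊆ S := by
    intro w hw
    rw [hTdef, Finset.mem_singleton] at hw
    rw [hmemS, hw, hv₅]; decide
  -- good reduction outside S
  have hS : ∀ w : HeightOneSpectrum (𝓞 ℚ), w ∉ S →
      W.HasGoodReductionAt w ∧ F.HasGoodReductionAt w ∧ ((5 : ℕ) : 𝓞 ℚ) ∉ w.asIdeal := by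
    intro w hwS
    have hwL : (e w : ℕ) ∉ L := fun h ↦ hwS ((hmemS w).mpr h)
    have hq : (e w : ℕ).Prime := (e w).2
    refine ⟨?_, ?_, natCast_not_mem_of_primesEquiv_ne w Fact.out fun h ↦ hwL ?_⟩
    · rw [hWeq]; exact hasGoodReductionAt_mk_of_primesEquiv _ _ _ _ _ w rfl fun h ↦ hwL (hΔE _ hq h)
    · rw [hFeq]; exact hasGoodReductionAt_mk_of_primesEquiv _ _ _ _ _ w rfl fun h ↦ hwL (hΔF _ hq h)
    · show (primesEquiv w : ℕ) ∈ L
      rw [h]; decide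
  -- the paid place 5: `#F(ℚ₅)[5] · #(ℤ₅/5) = 1 · 5 < 25 ≤ 5 ^ rank F`
  have hcard5 : ∏ w ∈ T, Nat.card (w.adicCompletionIntegers ℚ ⧸
      Ideal.span {((5 : ℕ) : w.adicCompletionIntegers ℚ)}) = 5 ^ Module.finrank ℚ ℚ :=
    WeierstrassCurve.prod_natCard_quot_adicCompletionIntegers (K := ℚ) (p := 5) T fun w hw h ↦
      hw (by rw [hTdef, Finset.mem_singleton]; exact heq5 w (primesEquiv_eq_of_natCast_mem Fact.out h))
  have hT : (∏ w ∈ T, Nat.card (nsmulAddMonoidHom 5 :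
        (F.baseChange (w.adicCompletion ℚ)).toAffine.Point →+ _).ker *
        Nat.card (w.adicCompletionIntegers ℚ ⧸
          Ideal.span {((5 : ℕ) : w.adicCompletionIntegers ℚ)})) < 5 ^ F.mordellWeilRank := by
    rw [Finset.prod_mul_distrib, hcard5, Module.finrank_self, hTdef, Finset.prod_singleton, h5 v₅ hv₅]
    calc (1 : ℕ) * 5 ^ 1 < 5 ^ 2 := by norm_num
      _ ≤ 5 ^ F.mordellWeilRank := Nat.pow_le_pow_right (by norm_num) hrank
  -- the free places
  have hplaces : ∀ w ∈ S, w ∉ T →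
      (((5 : ℕ) : 𝓞 ℚ) ∉ w.asIdeal ∧ Nat.card (nsmulAddMonoidHom 5 :
          (F.baseChange (w.adicCompletion ℚ)).toAffine.Point →+ _).ker = 1) ∨
      (W.HasSplitMultiplicativeReductionAt w ∧ F.HasSplitMultiplicativeReductionAt w ∧
        Nat.card (nsmulAddMonoidHom 5 :
          (W.baseChange (w.adicCompletion ℚ)).toAffine.Point →+ _).ker ≤ 5) ∨
      (W.HasMultiplicativeReductionAt w ∧ F.HasMultiplicativeReductionAt w ∧
        (∃ r : w.adicCompletion ℚ, algebraMap ℚ (w.adicCompletion ℚ) (-(W.c₄ / W.c₆)) =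
          r ^ 2 * algebraMap ℚ (w.adicCompletion ℚ) (-(F.c₄ / F.c₆))) ∧
        (∀ ζ : w.adicCompletion ℚ, ζ ^ 5 = 1 → ζ = 1)) ∨
      ((W.HasMultiplicativeReductionAt w ∧ ¬ W.HasSplitMultiplicativeReductionAt w ∧
          F.HasGoodReductionAt w) ∨
        (W.HasGoodReductionAt w ∧ F.HasMultiplicativeReductionAt w ∧
          ¬ F.HasSplitMultiplicativeReductionAt w)) := by
    intro w hwS hwT
    have hwL : (e w : ℕ) ∈ L := (hmemS w).mp hwS
    have hw5 : (e w : ℕ) ≠ 5 := fun h ↦ hwT (by rw [hTdef, Finset.mem_singleton]; exact heq5 w h)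
    have hcases : (e w : ℕ) = 2 ∨ (e w : ℕ) = 17 ∨ (e w : ℕ) = 19 ∨ (e w : ℕ) = 23 ∨ (e w : ℕ) = 29 := by
      simp only [hL, List.mem_cons, List.mem_nil_iff, or_false] at hwL
      omega
    rcases hcases with hw | hw | hw | hw | hw
    · -- 2: both multiplicative (kernel), same γ-class and μ₅(ℚ₂) = 1 (binders)
      exact Or.inr (Or.inr (Or.inl ⟨hasMultiplicativeReductionAt_of_intModel_of_primesEquiv hIW w hw
        (by decide +kernel) (by decide +kernel), hasMultiplicativeReductionAt_of_intModel_of_primesEquiv hIF w hw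
        (by decide +kernel) (by decide +kernel), h2 w hw⟩))
    · -- 17: kind (i)
      exact Or.inl ⟨natCast_not_mem_of_primesEquiv_ne w Fact.out hw5, h17 w hw⟩
    · -- 19: kind (iv): E good, F non-split multiplicative (all kernel)
      refine Or.inr (Or.inr (Or.inr (Or.inr ⟨?_, ?_, ?_⟩)))
      · rw [hWeq]; exact hasGoodReductionAt_mk_of_primesEquiv _ _ _ _ _ w hw (by decide +kernel)
      · exact hasMultiplicativeReductionAt_of_intModel_of_primesEquiv hIF w hw (by decide +kernel)
          (by decide +kernel)
      · exact not_hasSplitMultiplicativeReductionAt_of_intModel_of_noroot hIF w hw (by decide +kernel)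
          (by decide +kernel) noroot_c430882i1_19
    · -- 23: kind (i)
      exact Or.inl ⟨natCast_not_mem_of_primesEquiv_ne w Fact.out hw5, h23 w hw⟩
    · -- 29: both multiplicative (kernel), same γ-class and μ₅(ℚ₂₉) = 1 (binders)
      exact Or.inr (Or.inr (Or.inl ⟨hasMultiplicativeReductionAt_of_intModel_of_primesEquiv hIW w hw
        (by decide +kernel) (by decide +kernel), hasMultiplicativeReductionAt_of_intModel_of_primesEquiv hIF w hw
        (by decide +kernel) (by decide +kernel), h29 w hw⟩))
  exact X6RankZero.bsdp_of_casselsTate_of_congr_of_places₄ hCT hW hGZK hmod hU hU2 hF44 W 5 (by norm_num) hX hr0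
    hq hv F θ hθ S T hTS hS hT hplaces


/-! ### §4. The `5`-congruence IN THE KERNEL: `430882i1` is the member `(λ : μ) = (−641807 : 1)` of Fisher's Hesse
pencil `X_E(5)` of `22678e1` (Fisher 2012 Thm. 13.2; kit j154562 located it, the kernel re-verifies the two identities) -/

/-- **`BSD(E,5)` for `22678e1` with the `5`-congruence PROVED in the kernel** (modulo the named fact Fisher 2012
Thm. 13.2 `hF13`): `F = 430882i1` is ℚ-isomorphic to the member `E_{λ,μ}` of the Hesse pencil of `E = 22678e1` at
`(λ : μ) = (−641807 : 1)` — the two covariant identities `𝔠₄(λ,μ) = u⁴·c₄(F)`, `𝔠₆(λ,μ) = u⁶·c₆(F)` with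
`u = 207777213817353652567632204791808`, `c₄(E) = −150732223775`, `c₆(E) = 120949842824941103`, `c₄(F) = 678145`,
`c₆(F) = 557057663` are checked by `norm_num` on the closed forms `eval_hesseC4` / `eval_hesseC6` (x11a / eng-2), and
`fiveCongruent_of_hesseCertificate` turns them into a `Γ_ℚ`-isomorphism `θ : F[5] ≅ E[5]` (the rational root
`λ = −641807` of `j(E_{λ,1}) = j(F)` was found by PARI `nfroots`, kit j154562; the kernel does not trust it, it
re-verifies).  Remaining displayed binders: exactly those of `bsdp_x6r0vis_22678e1_5_of_congr` minus `θ`, `hθ`.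
Per pair (an OFFER for referee A); NOT a class theorem; nothing booked.
[cite: Fisher2012Hessian, Thm. 13.2] [cite: Wuthrich2014, Prop. 21 (p. 400)] [cite: Fisher2016Visualizing7, Thm. 4.4 (p. 106)]
[cite: CremonaMazur2000, §3 and Table 1] [cite: Cremona2006, Table 1 (Cremona labels 22678e1, 430882i1)] -/
theorem bsdp_x6r0vis_22678e1_5
    (hCT : exists_casselsTate_pairing (K := ℚ)) (hW : sha_dvd_analyticSha)
    (hGZK : rank_eq_analyticRank_of_analyticRank_le_one) (hmod : hasEntireLFunction_rat)
    (hU : Silverman1994_thmV53_tateUniformisation.{0})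
    (hU2 : Silverman1994_thmV53_corV54_tateUniformisation.{0})
    (hF44 : thm44_selmerLocalKer_iff_of_nonsplit_good) (hF13 : thm132_fiveCongruent_hessePencil)
    {W F : WeierstrassCurve ℚ} [W.IsElliptic] [W.IsGloballyMinimal] [F.IsElliptic] [F.IsGloballyMinimal]
    (hWeq : W = ⟨1, 0, 0, 3140254662, -139987982322460⟩) (hFeq : F = ⟨1, 0, 0, -14128, -645920⟩)
    (hr0 : W.analyticRank = 0) {q : ℚ} (hq : shaAn W = (q : ℂ)) (hv : padicValRat 5 q ≤ 2)
    (hrank : 2 ≤ F.mordellWeilRank)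
    (h5 : ∀ w : HeightOneSpectrum (𝓞 ℚ), (primesEquiv w : ℕ) = 5 →
      Nat.card (nsmulAddMonoidHom 5 : (F.baseChange (w.adicCompletion ℚ)).toAffine.Point →+ _).ker = 1)
    (h17 : ∀ w : HeightOneSpectrum (𝓞 ℚ), (primesEquiv w : ℕ) = 17 →
      Nat.card (nsmulAddMonoidHom 5 : (F.baseChange (w.adicCompletion ℚ)).toAffine.Point →+ _).ker = 1)
    (h23 : ∀ w : HeightOneSpectrum (𝓞 ℚ), (primesEquiv w : ℕ) = 23 →
      Nat.card (nsmulAddMonoidHom 5 : (F.baseChange (w.adicCompletion ℚ)).toAffine.Point →+ _).ker = 1)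
    (h2 : ∀ w : HeightOneSpectrum (𝓞 ℚ), (primesEquiv w : ℕ) = 2 →
      (∃ r : w.adicCompletion ℚ, algebraMap ℚ (w.adicCompletion ℚ) (-(W.c₄ / W.c₆)) =
          r ^ 2 * algebraMap ℚ (w.adicCompletion ℚ) (-(F.c₄ / F.c₆))) ∧
        (∀ ζ : w.adicCompletion ℚ, ζ ^ 5 = 1 → ζ = 1))
    (h29 : ∀ w : HeightOneSpectrum (𝓞 ℚ), (primesEquiv w : ℕ) = 29 →
      (∃ r : w.adicCompletion ℚ, algebraMap ℚ (w.adicCompletion ℚ) (-(W.c₄ / W.c₆)) =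
          r ^ 2 * algebraMap ℚ (w.adicCompletion ℚ) (-(F.c₄ / F.c₆))) ∧
        (∀ ζ : w.adicCompletion ℚ, ζ ^ 5 = 1 → ζ = 1)) :
    BSDp W 5 := by
  have hc4 : W.c₄ = (-150732223775 : ℚ) := by
    subst hWeq; norm_num [WeierstrassCurve.c₄, WeierstrassCurve.b₂, WeierstrassCurve.b₄]
  have hc6 : W.c₆ = (120949842824941103 : ℚ) := by
    subst hWeq; norm_num [WeierstrassCurve.c₆, WeierstrassCurve.b₂, WeierstrassCurve.b₄, WeierstrassCurve.b₆]
  have hc4F : F.c₄ = (678145 : ℚ) := by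
    subst hFeq; norm_num [WeierstrassCurve.c₄, WeierstrassCurve.b₂, WeierstrassCurve.b₄]
  have hc6F : F.c₆ = (557057663 : ℚ) := by
    subst hFeq; norm_num [WeierstrassCurve.c₆, WeierstrassCurve.b₂, WeierstrassCurve.b₄, WeierstrassCurve.b₆]
  obtain ⟨θ, hθ⟩ := fiveCongruent_of_hesseCertificate hF13 W F (-641807 : ℚ) 1
    (207777213817353652567632204791808 : ℚ) (by norm_num)
    (by rw [hc4, hc6, hc4F, eval_hesseC4]; norm_num) (by rw [hc4, hc6, hc6F, eval_hesseC6]; norm_num)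
  exact bsdp_x6r0vis_22678e1_5_of_congr hCT hW hGZK hmod hU hU2 hF44 hWeq hFeq hr0 hq hv θ hθ hrank h5 h17 h23
    h2 h29

end Summit.BirchSwinnertonDyer.Rank1Residual.Supersingular

end
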